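import Mathlib

/-!
# Tower transfer: the Temple–Kato occupation-transfer lemma and the double-commutator excess

Kernel K30 of the solo-blind programme (session s63).  Finite-dimensional (indeed arbitrary) real
inner-product spaces; Mathlib only.

Setting (ATTEMPTS A152, SYNOPSIS §4 N20).  `H` is a symmetric operator (the Hamiltonian restricted to
the direct sum of three neighbouring particle-number sectors), `ψ` a normalised eigenvector
`H ψ = e • ψ` (the ground state of sector `n`), and `(B, B')` an adjoint pair
(`⟪B u, v⟫ = ⟪u, B' v⟫`; `B` = the zero-momentum annihilator `b₀`, `B'` = `b₀†`).  The zero-mode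
occupation of a vector `u` is `‖B u‖² / ‖u‖²`.

Results.
* `double_commutator_expect` — `⟪ψ, [B', [H, B]] ψ⟫ = (⟪Bψ, H Bψ⟫ - e‖Bψ‖²) + (⟪B'ψ, H B'ψ⟫ - e‖B'ψ‖²)`
  for an eigenvector `ψ` (the four-term expansion of the double commutator on the left);
* `sector_excess_bound` — with the variational bound `(e⁺ - e)‖B'ψ‖² ≤ ⟪B'ψ, H B'ψ⟫ - e‖B'ψ‖²`
  in the upper sector, the excess of `Bψ` over the lower-sector level `e⁻` is
  `⟪Bψ, H Bψ⟫ - e⁻‖Bψ‖² ≤ D - (e⁺ - e)‖B'ψ‖² + (e - e⁻)‖Bψ‖²`, and `excess_le_of_convex` — if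
  `‖B'ψ‖² = ‖Bψ‖² + κ` (the commutator `[B, B'] = κ` in the state) and `e⁺ + e⁻ - 2e ≥ 0` (the
  sector energies are locally convex at `n`, e.g. `n` is an energy-minimising sector) then
  `⟪Bψ, H Bψ⟫ - e⁻‖Bψ‖² ≤ D - (e⁺ - e) κ`: an `O(1)` total excess, i.e. `O(1/‖Bψ‖²)` per unit
  norm — the Anderson-tower scale `1/V` when `‖Bψ‖² = n₀(ψ) ≍ V`;
* `descent_norm_sq_le`, `descent_occupation` — Cauchy–Schwarz descent: the occupation of the
  descended state `Bψ/‖Bψ‖` is at least `‖Bψ‖² - κ'` where `‖B'(Bψ)‖² = ‖B(Bψ)‖² + κ'‖Bψ‖²`;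
* `temple_kato_component` — for a normalised eigenvector `ψ'` of `H` with a gap `γ` on its
  orthogonal complement, every unit vector `Φ` has `γ ‖Φ - ⟪ψ', Φ⟫ ψ'‖² ≤ ⟪Φ, H Φ⟫ - e'`;
* `occupation_transfer` — hence, if `‖B u‖ ≤ M‖u‖` and `⟪Φ, H Φ⟫ - e' ≤ γ δ²`, then
  `‖B ψ'‖ ≥ ‖B Φ‖ - M δ`: the square root of the zero-mode occupation passes from a low-energy
  unit vector `Φ` to the ground state `ψ'` of its sector with loss `M δ`.
Composition (paper level, A152): hard-core lattice bosons at the reflection-positive point, `Φ` the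
normalised tower state `b₀ᵏ ψ_{n*}`, excess `≤ C₂k²/V` [Tasaki 2019, Thm 3.1], `M² ≤ V/4 + 1`; a
sector gap `γ ≥ 16 C₂ k² / (c₀ V)` transfers the long-range order `n₀ ≥ c₀ V` of the anchor to the
sector ground state `n* - k`.  The gap is the (open) hypothesis.
-/

namespace Summit.AtomisticToContinuum.BoseEinsteinCondensation.Theorems

open scoped InnerProductSpace

section TowerTransfer

variable {E : Type*} [NormedAddCommGroup E] [InnerProductSpace ℝ E]

/-- **Double-commutator identity.**  For a symmetric `H`, an eigenvector `H ψ = e • ψ` and an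
adjoint pair `(B, B')`, the expectation of `[B', [H, B]] = B'HB - B'BH - HBB' + BHB'` in `ψ`
equals the sum of the two sector excesses `⟪Bψ, (H - e) Bψ⟫ + ⟪B'ψ, (H - e) B'ψ⟫`. -/
theorem double_commutator_expect (H B B' : E →ₗ[ℝ] E)
    (hH : ∀ u v : E, ⟪H u, v⟫_ℝ = ⟪u, H v⟫_ℝ)
    (hadj : ∀ u v : E, ⟪B u, v⟫_ℝ = ⟪u, B' v⟫_ℝ)
    (ψ : E) (e : ℝ) (hψ : H ψ = e • ψ) :
    ⟪ψ, B' (H (B ψ))⟫_ℝ - ⟪ψ, B' (B (H ψ))⟫_ℝ - ⟪ψ, H (B (B' ψ))⟫_ℝ + ⟪ψ, B (H (B' ψ))⟫_ℝ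
      = (⟪B ψ, H (B ψ)⟫_ℝ - e * ‖B ψ‖ ^ 2) + (⟪B' ψ, H (B' ψ)⟫_ℝ - e * ‖B' ψ‖ ^ 2) := by
  have h1 : ⟪ψ, B' (H (B ψ))⟫_ℝ = ⟪B ψ, H (B ψ)⟫_ℝ := (hadj ψ (H (B ψ))).symm
  have h2 : ⟪ψ, B' (B (H ψ))⟫_ℝ = e * ‖B ψ‖ ^ 2 := by
    calc ⟪ψ, B' (B (H ψ))⟫_ℝ = ⟪B ψ, B (H ψ)⟫_ℝ := (hadj ψ (B (H ψ))).symm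
      _ = ⟪B ψ, B (e • ψ)⟫_ℝ := by rw [hψ]
      _ = e * ⟪B ψ, B ψ⟫_ℝ := by rw [map_smul, real_inner_smul_right]
      _ = e * ‖B ψ‖ ^ 2 := by rw [real_inner_self_eq_norm_sq]
  have h3 : ⟪ψ, H (B (B' ψ))⟫_ℝ = e * ‖B' ψ‖ ^ 2 := by
    calc ⟪ψ, H (B (B' ψ))⟫_ℝ = ⟪H ψ, B (B' ψ)⟫_ℝ := (hH ψ (B (B' ψ))).symm
      _ = ⟪e • ψ, B (B' ψ)⟫_ℝ := by rw [hψ]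
      _ = e * ⟪ψ, B (B' ψ)⟫_ℝ := by rw [real_inner_smul_left]
      _ = e * ⟪B (B' ψ), ψ⟫_ℝ := by rw [real_inner_comm (B (B' ψ)) ψ]
      _ = e * ⟪B' ψ, B' ψ⟫_ℝ := by rw [hadj (B' ψ) ψ]
      _ = e * ‖B' ψ‖ ^ 2 := by rw [real_inner_self_eq_norm_sq]
  have h4 : ⟪ψ, B (H (B' ψ))⟫_ℝ = ⟪B' ψ, H (B' ψ)⟫_ℝ := by
    calc ⟪ψ, B (H (B' ψ))⟫_ℝ = ⟪B (H (B' ψ)), ψ⟫_ℝ := (real_inner_comm (B (H (B' ψ))) ψ)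
      _ = ⟪H (B' ψ), B' ψ⟫_ℝ := hadj (H (B' ψ)) ψ
      _ = ⟪B' ψ, H (B' ψ)⟫_ℝ := hH (B' ψ) (B' ψ)
  rw [h1, h2, h3, h4]
  ring

/-- **Sector excess bound.**  In the situation of `double_commutator_expect`, write `D` for the
double-commutator expectation.  If the raised vector `B'ψ` obeys the variational bound of the
upper sector, `(e⁺ - e) ‖B'ψ‖² ≤ ⟪B'ψ, H B'ψ⟫ - e ‖B'ψ‖²` (`e⁺` = the lowest level of that
sector), then the excess of the lowered vector `Bψ` over any level `e⁻` satisfies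
`⟪Bψ, H Bψ⟫ - e⁻ ‖Bψ‖² ≤ D - (e⁺ - e) ‖B'ψ‖² + (e - e⁻) ‖Bψ‖²`. -/
theorem sector_excess_bound (H B B' : E →ₗ[ℝ] E)
    (hH : ∀ u v : E, ⟪H u, v⟫_ℝ = ⟪u, H v⟫_ℝ)
    (hadj : ∀ u v : E, ⟪B u, v⟫_ℝ = ⟪u, B' v⟫_ℝ)
    (ψ : E) (e ep em D : ℝ) (hψ : H ψ = e • ψ)
    (hD : ⟪ψ, B' (H (B ψ))⟫_ℝ - ⟪ψ, B' (B (H ψ))⟫_ℝ - ⟪ψ, H (B (B' ψ))⟫_ℝ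
            + ⟪ψ, B (H (B' ψ))⟫_ℝ = D)
    (hvar : (ep - e) * ‖B' ψ‖ ^ 2 ≤ ⟪B' ψ, H (B' ψ)⟫_ℝ - e * ‖B' ψ‖ ^ 2) :
    ⟪B ψ, H (B ψ)⟫_ℝ - em * ‖B ψ‖ ^ 2
      ≤ D - (ep - e) * ‖B' ψ‖ ^ 2 + (e - em) * ‖B ψ‖ ^ 2 := by
  have hid := double_commutator_expect H B B' hH hadj ψ e hψ
  rw [hD] at hid
  linarith

/-- **The tower scale.**  If moreover `‖B'ψ‖² = ‖Bψ‖² + κ` (the commutator `[B, B']` is the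
scalar `κ` in the state `ψ`) and the three sector levels are locally convex, `0 ≤ e⁺ + e⁻ - 2e`
(automatic when `e` is the least of all sector levels), then
`⟪Bψ, H Bψ⟫ - e⁻ ‖Bψ‖² ≤ D - (e⁺ - e) κ`: the total excess of the lowered vector is `O(1)`, so
the excess per unit norm is `O(1/‖Bψ‖²)`. -/
theorem excess_le_of_convex (H B B' : E →ₗ[ℝ] E)
    (hH : ∀ u v : E, ⟪H u, v⟫_ℝ = ⟪u, H v⟫_ℝ)
    (hadj : ∀ u v : E, ⟪B u, v⟫_ℝ = ⟪u, B' v⟫_ℝ)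
    (ψ : E) (e ep em D κ : ℝ) (hψ : H ψ = e • ψ)
    (hD : ⟪ψ, B' (H (B ψ))⟫_ℝ - ⟪ψ, B' (B (H ψ))⟫_ℝ - ⟪ψ, H (B (B' ψ))⟫_ℝ
            + ⟪ψ, B (H (B' ψ))⟫_ℝ = D)
    (hvar : (ep - e) * ‖B' ψ‖ ^ 2 ≤ ⟪B' ψ, H (B' ψ)⟫_ℝ - e * ‖B' ψ‖ ^ 2)
    (hcomm : ‖B' ψ‖ ^ 2 = ‖B ψ‖ ^ 2 + κ) (hconv : 0 ≤ ep + em - 2 * e) :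
    ⟪B ψ, H (B ψ)⟫_ℝ - em * ‖B ψ‖ ^ 2 ≤ D - (ep - e) * κ := by
  have h := sector_excess_bound H B B' hH hadj ψ e ep em D hψ hD hvar
  rw [hcomm] at h
  have h0 : 0 ≤ ‖B ψ‖ ^ 2 := by positivity
  nlinarith [h, hconv, h0, mul_nonneg hconv h0]

/-- **Cauchy–Schwarz descent** (product form).  For an adjoint pair `(B, B')` and any `ψ`:
`‖Bψ‖⁴ ≤ ‖ψ‖² ‖B'(Bψ)‖²`. -/
theorem descent_norm_sq_le (B B' : E →ₗ[ℝ] E)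
    (hadj : ∀ u v : E, ⟪B u, v⟫_ℝ = ⟪u, B' v⟫_ℝ) (ψ : E) :
    ‖B ψ‖ ^ 2 * ‖B ψ‖ ^ 2 ≤ ‖ψ‖ ^ 2 * ‖B' (B ψ)‖ ^ 2 := by
  have heq : ⟪ψ, B' (B ψ)⟫_ℝ = ‖B ψ‖ ^ 2 := by
    rw [← hadj (ψ) (B ψ), real_inner_self_eq_norm_sq]
  have hcs : ⟪ψ, B' (B ψ)⟫_ℝ ≤ ‖ψ‖ * ‖B' (B ψ)‖ := real_inner_le_norm ψ (B' (B ψ))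
  rw [heq] at hcs
  have h0 : 0 ≤ ‖B ψ‖ ^ 2 := by positivity
  have h1 : 0 ≤ ‖ψ‖ * ‖B' (B ψ)‖ := mul_nonneg (norm_nonneg _) (norm_nonneg _)
  nlinarith [hcs, h0, h1, mul_le_mul hcs hcs h0 h1]

/-- **Descent of the occupation.**  If `‖ψ‖ = 1`, `Bψ ≠ 0` and `‖B'(Bψ)‖² = ‖B(Bψ)‖² + κ' ‖Bψ‖²`
(the commutator `[B, B'] = κ'` in the lowered sector), then the occupation of the normalised lowered
vector is at least the occupation of `ψ` minus `κ'`: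
`‖Bψ‖² - κ' ≤ ‖B(Bψ)‖² / ‖Bψ‖²`. -/
theorem descent_occupation (B B' : E →ₗ[ℝ] E)
    (hadj : ∀ u v : E, ⟪B u, v⟫_ℝ = ⟪u, B' v⟫_ℝ) (ψ : E) (κ' : ℝ)
    (hunit : ‖ψ‖ = 1) (hBψ : B ψ ≠ 0)
    (hcomm : ‖B' (B ψ)‖ ^ 2 = ‖B (B ψ)‖ ^ 2 + κ' * ‖B ψ‖ ^ 2) :
    ‖B ψ‖ ^ 2 - κ' ≤ ‖B (B ψ)‖ ^ 2 / ‖B ψ‖ ^ 2 := by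
  have h := descent_norm_sq_le B B' hadj ψ
  rw [hunit, one_pow, one_mul, hcomm] at h
  have hq : 0 < ‖B ψ‖ ^ 2 := by
    have : 0 < ‖B ψ‖ := norm_pos_iff.mpr hBψ
    positivity
  have hq' : ‖B ψ‖ ^ 2 ≠ 0 := hq.ne'
  have hmain : (‖B ψ‖ ^ 2 - κ') * ‖B ψ‖ ^ 2 ≤ ‖B (B ψ)‖ ^ 2 := by nlinarith [h]
  have hq0 : 0 ≤ ‖B ψ‖ ^ 2 := hq.le
  calc ‖B ψ‖ ^ 2 - κ' = (‖B ψ‖ ^ 2 - κ') * ‖B ψ‖ ^ 2 / ‖B ψ‖ ^ 2 := by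
        field_simp
    _ ≤ ‖B (B ψ)‖ ^ 2 / ‖B ψ‖ ^ 2 := by gcongr

/-- **Temple–Kato component bound.**  Let `ψ'` be a normalised eigenvector of the symmetric `H`,
`H ψ' = e' • ψ'`, with a gap `γ` on its orthogonal complement:
`(e' + γ) ‖χ‖² ≤ ⟪χ, H χ⟫` whenever `⟪χ, ψ'⟫ = 0`.  Then for every unit vector `Φ` the component
orthogonal to `ψ'` is controlled by the excess energy: `γ ‖Φ - ⟪ψ', Φ⟫ ψ'‖² ≤ ⟪Φ, H Φ⟫ - e'`. -/
theorem temple_kato_component (H : E →ₗ[ℝ] E) (hH : ∀ u v : E, ⟪H u, v⟫_ℝ = ⟪u, H v⟫_ℝ)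
    (ψ' : E) (e' γ : ℝ) (hψ' : H ψ' = e' • ψ') (hunit : ‖ψ'‖ = 1)
    (hgap : ∀ χ : E, ⟪χ, ψ'⟫_ℝ = 0 → (e' + γ) * ‖χ‖ ^ 2 ≤ ⟪χ, H χ⟫_ℝ)
    (Φ : E) (hΦ : ‖Φ‖ = 1) :
    γ * ‖Φ - ⟪ψ', Φ⟫_ℝ • ψ'‖ ^ 2 ≤ ⟪Φ, H Φ⟫_ℝ - e' := by
  have hχ : ⟪Φ - ⟪ψ', Φ⟫_ℝ • ψ', ψ'⟫_ℝ = 0 := by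
    rw [inner_sub_left, real_inner_smul_left, real_inner_self_eq_norm_sq, hunit, one_pow,
      mul_one, real_inner_comm ψ' Φ, sub_self]
  have hHψΦ : ⟪Φ, H ψ'⟫_ℝ = e' * ⟪ψ', Φ⟫_ℝ := by
    rw [hψ', real_inner_smul_right, real_inner_comm ψ' Φ]
  have hψHΦ : ⟪ψ', H Φ⟫_ℝ = e' * ⟪ψ', Φ⟫_ℝ := by
    rw [← hH ψ' Φ, hψ', real_inner_smul_left]
  have hψHψ : ⟪ψ', H ψ'⟫_ℝ = e' := by
    rw [hψ', real_inner_smul_right, real_inner_self_eq_norm_sq, hunit]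
    ring
  have hχH : ⟪Φ - ⟪ψ', Φ⟫_ℝ • ψ', H (Φ - ⟪ψ', Φ⟫_ℝ • ψ')⟫_ℝ
      = ⟪Φ, H Φ⟫_ℝ - e' * ⟪ψ', Φ⟫_ℝ ^ 2 := by
    simp only [map_sub, map_smul, inner_sub_left, inner_sub_right, real_inner_smul_left,
      real_inner_smul_right, hHψΦ, hψHΦ, hψHψ]
    ring
  have hχnorm : ‖Φ - ⟪ψ', Φ⟫_ℝ • ψ'‖ ^ 2 = 1 - ⟪ψ', Φ⟫_ℝ ^ 2 := by
    rw [← real_inner_self_eq_norm_sq]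
    simp only [inner_sub_left, inner_sub_right, real_inner_smul_left, real_inner_smul_right]
    simp only [real_inner_self_eq_norm_sq, hunit, hΦ, real_inner_comm ψ' Φ]
    ring
  have hg := hgap _ hχ
  rw [hχH, hχnorm] at hg
  rw [hχnorm]
  nlinarith [hg, sq_nonneg ⟪ψ', Φ⟫_ℝ]

/-- **Occupation transfer (one tower step).**  In the situation of `temple_kato_component`, let
`B` be bounded, `‖B u‖ ≤ M ‖u‖`, and let the unit vector `Φ` have excess energy
`⟪Φ, H Φ⟫ - e' ≤ γ δ²`.  Then `‖B ψ'‖ ≥ ‖B Φ‖ - M δ`: the (square root of the) zero-mode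
occupation of `Φ` passes to the ground state `ψ'` with loss `M δ`. -/
theorem occupation_transfer (H B : E →ₗ[ℝ] E) (hH : ∀ u v : E, ⟪H u, v⟫_ℝ = ⟪u, H v⟫_ℝ)
    (ψ' : E) (e' γ M δ : ℝ) (hψ' : H ψ' = e' • ψ') (hunit : ‖ψ'‖ = 1) (hγ : 0 < γ)
    (hM : 0 ≤ M) (hδ : 0 ≤ δ)
    (hgap : ∀ χ : E, ⟪χ, ψ'⟫_ℝ = 0 → (e' + γ) * ‖χ‖ ^ 2 ≤ ⟪χ, H χ⟫_ℝ)
    (hB : ∀ u : E, ‖B u‖ ≤ M * ‖u‖)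
    (Φ : E) (hΦ : ‖Φ‖ = 1) (hε : ⟪Φ, H Φ⟫_ℝ - e' ≤ γ * δ ^ 2) :
    ‖B Φ‖ - M * δ ≤ ‖B ψ'‖ := by
  have htk := temple_kato_component H hH ψ' e' γ hψ' hunit hgap Φ hΦ
  have h1 : ‖Φ - ⟪ψ', Φ⟫_ℝ • ψ'‖ ^ 2 ≤ δ ^ 2 :=
    le_of_mul_le_mul_left (by linarith [htk, hε]) hγ
  have h2 : ‖Φ - ⟪ψ', Φ⟫_ℝ • ψ'‖ ≤ δ := by
    nlinarith [h1, norm_nonneg (Φ - ⟪ψ', Φ⟫_ℝ • ψ'), hδ]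
  have hα : |⟪ψ', Φ⟫_ℝ| ≤ 1 := by
    have h := abs_real_inner_le_norm ψ' Φ
    rw [hunit, hΦ, one_mul] at h
    exact h
  have hdec : B Φ = ⟪ψ', Φ⟫_ℝ • B ψ' + B (Φ - ⟪ψ', Φ⟫_ℝ • ψ') := by
    rw [map_sub, map_smul]
    abel
  have hBχ := hB (Φ - ⟪ψ', Φ⟫_ℝ • ψ')
  have hMχ : M * ‖Φ - ⟪ψ', Φ⟫_ℝ • ψ'‖ ≤ M * δ := mul_le_mul_of_nonneg_left h2 hM
  have htri : ‖B Φ‖ ≤ ‖⟪ψ', Φ⟫_ℝ • B ψ'‖ + ‖B (Φ - ⟪ψ', Φ⟫_ℝ • ψ')‖ := by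
    rw [hdec]
    exact norm_add_le _ _
  have hsm : ‖⟪ψ', Φ⟫_ℝ • B ψ'‖ = |⟪ψ', Φ⟫_ℝ| * ‖B ψ'‖ := by
    rw [norm_smul, Real.norm_eq_abs]
  have hsm' : |⟪ψ', Φ⟫_ℝ| * ‖B ψ'‖ ≤ 1 * ‖B ψ'‖ :=
    mul_le_mul_of_nonneg_right hα (norm_nonneg _)
  linarith [htri, hsm, hsm', hBχ, hMχ]

end TowerTransfer

end Summit.AtomisticToContinuum.BoseEinsteinCondensation.Theorems
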